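import Literature.NumberTheory.EllipticCurves.HeegnerPointsRationalityProofs
import Literature.NumberTheory.EllipticCurves.HeegnerPointReflectionProofs
import Literature.NumberTheory.EllipticCurves.HeegnerPointsOfConductor
import Literature.NumberTheory.EllipticCurves.Sha

/-!
# Sketch — crux idea `s3-fibre-transport-w2b` (stmt-BirchSwinnertonDyer-19804, stub `stub_levelFixingSeven` = (W2-b))

First-lemma signatures over existing declarations (planner bsd-idea-20 g49). Nothing here is
registered; the line of record stays `Lines/coupled_variantQ.lean`.

The lever: `Dt.deg = 6` pins `Dt.φ : ℍ → E₉(ℂ)` to (±) the optimal quotient `X₀(243) → X₀(243)/S₃ = E₉`,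
`S₃ = ⟨A, W⟩` (`A = (28 1/3; 81 1)`, `W = w₂₄₃`), so `Dt.φ ∘ g = Dt.φ` for `g ∈ S₃` (`PhiInvariant`);
the decomposition involution `φ_w` at the prime `w ∣ 3` of `K` moves the level-243 Heegner point
`τ_n` INSIDE its `S₃`-orbit (`LatticePairIdentity`, the adele-free form of the kernel certificate
`thmC_shimura_certificate`, p452301), and the tree's PROVED `isAutEquivariantOnHeegner` turns
"transport into the orbit" into "fixes `y_n = Dt.φ τ_n`" (`fixOfTransport_of_phiInvariant`, proved below).
-/

noncomputable section

set_option linter.dupNamespace false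

open Complex UpperHalfPlane PeriodPair Field NumberField IsDedekindDomain
open scoped MatrixGroups Pointwise

namespace Summit.BirchSwinnertonDyer.BirchSwinnertonDyer.Cruxes.UpperOffV0HSYPlus.S3FibreTransport

open Literature.NumberTheory.EllipticCurves Literature.NumberTheory.EllipticCurves.ModularForms
open Literature.NumberTheory.EllipticCurves.ModularForms.ModularParametrizationData

/-- `E₉ = 243a1 : y² + y = x³ − 1` (`≅ x³ + y³ = 9`), the curve of the stub. -/
abbrev E9 : WeierstrassCurve ℚ := ⟨0, 0, 1, 0, -1⟩

/-- The level-`243` Heegner form `Q_n(p) = (81n²(p²+4p+16), −9n(4p²+17p+72), 4p²+18p+81)` of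
discriminant `−243p²n²` whose `heegnerTau` is the CM point of the stub (`τ_n = τ_1 / n`). -/
def formQ (p n : ℕ) : ℤ × ℤ × ℤ :=
  ((n : ℤ) ^ 2 * (81 * ((p : ℤ) ^ 2 + 4 * p + 16)), (n : ℤ) * (-(9 * (4 * (p : ℤ) ^ 2 + 17 * p + 72))),
    4 * (p : ℤ) ^ 2 + 18 * p + 81)

/-- Its discriminant. -/
def discQ (p n : ℕ) : ℤ := -243 * (p : ℤ) ^ 2 * (n : ℤ) ^ 2

theorem disc_formQ (p n : ℕ) :
    (formQ p n).2.1 ^ 2 - 4 * (formQ p n).1 * (formQ p n).2.2 = discQ p n := by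
  simp only [formQ, discQ]; ring

/-- `3A = (84 1; 243 3) ∈ GL₂(ℚ)` (`det = 9 > 0`): the Atkin–Lehner-type element of the normaliser of
`Γ₀(3⁵)` of Hu–Shu–Yin §2.1 (same Möbius action as `A = (28 1/3; 81 1)`). -/
def atkinA : GL (Fin 2) ℚ :=
  Matrix.GeneralLinearGroup.mkOfDetNeZero !![(84 : ℚ), 1; 243, 3] (by norm_num [Matrix.det_fin_two])

/-- The exponent `a(p)·n mod 3` naming the orbit partner `A^{a} W · τ_n` of `τ_n` under `φ_w`
(`a(p) = 2, 1, 0` for `p ≡ 7, 16, 25 (mod 27)` — the exponent of `thmC_shimura_certificate`). -/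
def expo (p n : ℕ) : ℕ := ((if p % 27 = 7 then 2 else if p % 27 = 16 then 1 else 0) * n) % 3

/-- The orbit partner `g(p,n) = (3A)^{expo} · w₂₄₃ ∈ GL₂(ℚ)`. -/
def partner (p n : ℕ) : GL (Fin 2) ℚ := atkinA ^ expo p n * (frickeGL 243 : GL (Fin 2) ℚ)

/-- **The local modification at `w ∣ 3`.** `M_w(Λ) = {x : x ∈ Λ ⊗ ℤ_ℓ for all ℓ ≠ 3, √−3·x ∈ Λ ⊗ ℤ₃}`
— the lattice `s_w⁻¹ Λ` for the idele `s_w = (√−3 at w, 1 elsewhere)` of `K = ℚ(√−3)`, written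
without adeles (`[M_w]² = [3⁻¹·] = 1` on homothety classes). -/
def Mw (Λ : Submodule ℤ ℂ) : Set ℂ :=
  {x | (∃ k : ℕ, (3 : ℂ) ^ k * x ∈ Λ) ∧ (∃ m : ℕ, ¬ 3 ∣ m ∧ (m : ℂ) * (sqrtDisc (-3) * x) ∈ Λ)}

/-- **S2 = (C1)ₙ, the lattice-pair identity** (pure 3-local algebra; certificate-able uniformly in
`p = 27s + r`, `n`; verified exactly for 21 pairs `(p, n)` incl. the controls `p ≡ 4 (9)` where it
fails for every `g ∈ S₃`): `φ_w` moves the level-243 pair `(Λ_{τ_n}, Λ_{243τ_n})` to the pair of the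
orbit partner `g(p,n)·τ_n`, with ONE homothety factor. -/
def LatticePairIdentity : Prop :=
  ∀ p : ℕ, p.Prime → p % 9 = 7 → ∀ n : ℕ, n ≠ 0 → (∀ q ∈ n.primeFactors, q % 3 = 2) →
    ∃ μ : ℂ, μ ≠ 0 ∧
      Mw (ofUpperHalfPlane (heegnerTau (formQ p n))).lattice =
        μ • ((ofUpperHalfPlane (glCast (partner p n) • heegnerTau (formQ p n))).lattice : Set ℂ) ∧
      Mw (ofUpperHalfPlane (levelPoint 243 (heegnerTau (formQ p n)))).lattice =
        μ • ((ofUpperHalfPlane (levelPoint 243 (glCast (partner p n) • heegnerTau (formQ p n)))).lattice :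
          Set ℂ)

/-- **T = the CM input (INVOLUTION TRANSPORT), in the stub's own currency and WITHOUT adeles.**
For the non-trivial involution `φ` of the decomposition group at `v ∣ 3` in `Gal(K[9pn]/K)` (the
stub's `τ ↦ φ`), every automorphism `σ` of `ℂ` restricting to `φ` on `K[9pn] ⊂ ℂ` transports the
level-243 pair `(Λ_{τ_n}, Λ_{243τ_n})` to `(M_w Λ_{τ_n}, M_w Λ_{243τ_n})` up to ONE scalar.  Content:
Shimura's main theorem of CM for the proper `O_{9pn}`-lattice `Λ_{τ_n}` (IATAF Thm 5.4; Lang,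
*Elliptic Functions* Ch. 10 §2–3, idelic formulation for arbitrary lattices) at the idele
`s_w = (√−3)_w`, plus the naming `[s_w, K]|_{K[9pn]} = φ` (local reciprocity at the totally ramified
layer `K[9pn]/K[pn]`; `φ` = the unique involution of `D_w`, `#D_w = 18`; sign conventions are moot
because `φ² = 1` and `[M_w]² = 1`). -/
def InvolutionTransport : Prop :=
  ∀ (p : ℕ), p.Prime → p % 9 = 7 → ∀ (K : Type) [Field K] [NumberField K] (ω : K), ω ^ 2 + ω + 1 = 0 →
    Module.finrank ℚ K = 2 → ∀ (ι : K →+* ℂ) (v : HeightOneSpectrum (𝓞 K)), ((3 : ℕ) : 𝓞 K) ∈ v.asIdeal →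
    ∀ (n : ℕ), n ≠ 0 → (∀ q ∈ n.primeFactors, q % 3 = 2) →
    ∀ (e : ringClassField K ι (9 * p * n) →+* AlgebraicClosure K),
    (∀ k : K, e (algebraMap K (ringClassField K ι (9 * p * n)) k) = algebraMap K (AlgebraicClosure K) k) →
    ∀ (τ : absoluteGaloisGroup (v.adicCompletion K))
    (φ : ringClassField K ι (9 * p * n) ≃ₐ[K] ringClassField K ι (9 * p * n)),
    (∀ x : ringClassField K ι (9 * p * n), (show AlgebraicClosure K ≃ₐ[K] AlgebraicClosure K from
      resGal (K := K) (v.adicCompletion K) τ) (e x) = e (φ x)) → φ * φ = 1 → φ ≠ 1 →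
    ∀ (σ : ℂ ≃+* ℂ), (∀ x : ringClassField K ι (9 * p * n), σ (x : ℂ) = ((φ x : ringClassField K ι (9 * p * n)) : ℂ)) →
    ∀ (M M' : PeriodPair), IsTransportedBy σ (ofUpperHalfPlane (heegnerTau (formQ p n))) M →
      IsTransportedBy σ (ofUpperHalfPlane (levelPoint 243 (heegnerTau (formQ p n)))) M' →
      ∃ c : ℂ, c ≠ 0 ∧
        (M.lattice : Set ℂ) = c • Mw (ofUpperHalfPlane (heegnerTau (formQ p n))).lattice ∧
        (M'.lattice : Set ℂ) = c • Mw (ofUpperHalfPlane (levelPoint 243 (heegnerTau (formQ p n)))).lattice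

/-- **S1, orbit forms**: `τ_n` and its partner are level-`243` Heegner points of the same
discriminant (`W`-case = tree `HeegnerForm.fricke`; the `A`-cases are new but elementary). -/
def OrbitForms : Prop :=
  ∀ p : ℕ, p.Prime → p % 9 = 7 → ∀ n : ℕ, n ≠ 0 → (∀ q ∈ n.primeFactors, q % 3 = 2) →
    formQ p n ∈ heegnerForms 243 (discQ p n) ∧
      ∃ Q' ∈ heegnerForms 243 (discQ p n), heegnerTau Q' = glCast (partner p n) • heegnerTau (formQ p n)

/-- **INV, the `S₃`-invariance of a degree-6 parametrisation** (`deg = 6` ⇒ `Dt.φ = ±φ₀`,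
`φ₀ = X₀(243) → X₀(243)/⟨A, W⟩ = E₉`; `W`: `φ_frickeGL_smul` with Fricke sign `+1` and
`Dt.cuspZeroPoint = 0` since `L(E₉,1) = 0`; `A`: `f(τ + 1/3) = ζ₃^{±1} f(τ)` for the CM form and
`φ₀(cusp 1/81) = O`). -/
def PhiInvariant : Prop :=
  ∀ Dt : ModularParametrizationData E9 243, Dt.deg = 6 → ∀ τ : ℍ,
    Dt.φ (glCast (frickeGL 243 : GL (Fin 2) ℚ) • τ) = Dt.φ τ ∧ Dt.φ (glCast atkinA • τ) = Dt.φ τ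

/-- **First lemma (FIX-OF-TRANSPORT).** For a degree-6 datum, every automorphism of `ℂ` fixing
`√D` that level-transports `τ_n` to a Heegner point in its `⟨A, W⟩`-orbit FIXES `y_n = Dt.φ(τ_n)`. -/
def FixOfTransport : Prop :=
  ∀ Dt : ModularParametrizationData E9 243, Dt.deg = 6 →
    ∀ (p n : ℕ) (σ : ℂ ≃+* ℂ), σ (sqrtDisc (discQ p n)) = sqrtDisc (discQ p n) →
      formQ p n ∈ heegnerForms 243 (discQ p n) →
      (∃ g ∈ Subgroup.closure ({atkinA, (frickeGL 243 : GL (Fin 2) ℚ)} : Set (GL (Fin 2) ℚ)),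
        ∃ Q' ∈ heegnerForms 243 (discQ p n),
          heegnerTau Q' = glCast g • heegnerTau (formQ p n) ∧
          LevelTransport 243 σ (heegnerTau (formQ p n)) (heegnerTau Q')) →
      WeierstrassCurve.Affine.Point.map (σ : ℂ →+* ℂ).toRatAlgHom (Dt.φ (heegnerTau (formQ p n))) =
        Dt.φ (heegnerTau (formQ p n))

/-- INV ⇒ FIX-OF-TRANSPORT, through the tree's proved `isAutEquivariantOnHeegner`. -/
theorem fixOfTransport_of_phiInvariant (hinv : PhiInvariant) : FixOfTransport := by
  intro Dt hdeg p n σ hσ hQ ⟨g, hg, Q', hQ', hτ, hT⟩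
  have hequiv := Dt.isAutEquivariantOnHeegner (discQ p n) σ hσ hQ hQ' hT
  rw [hequiv, hτ]
  -- invariance of `Dt.φ` under the whole subgroup generated by `A` and `W`
  suffices H : ∀ g ∈ Subgroup.closure ({atkinA, (frickeGL 243 : GL (Fin 2) ℚ)} : Set (GL (Fin 2) ℚ)),
      ∀ τ : ℍ, Dt.φ (glCast g • τ) = Dt.φ τ from H g hg _
  intro g hg
  induction hg using Subgroup.closure_induction with
  | mem x hx =>
    rcases hx with rfl | rfl
    · exact fun τ ↦ (hinv Dt hdeg τ).2
    · exact fun τ ↦ (hinv Dt hdeg τ).1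
  | one => intro τ; simp
  | mul x y _ _ hx hy =>
    intro τ
    rw [show glCast (x * y) = glCast x * glCast y from map_mul _ x y, mul_smul, hx, hy]
  | inv x _ hx =>
    intro τ
    have h := hx ((glCast x)⁻¹ • τ)
    rw [smul_inv_smul] at h
    rw [show glCast x⁻¹ = (glCast x)⁻¹ from map_inv _ x]
    exact h.symm

end Summit.BirchSwinnertonDyer.BirchSwinnertonDyer.Cruxes.UpperOffV0HSYPlus.S3FibreTransport

end
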